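import Summits.AtomisticToContinuum.Crystallization.Theorems.FluxTubeKeplerFluxCellKeplerSingleScale
import Summits.AtomisticToContinuum.Crystallization.Theorems.FluxTubeKeplerFluxCellKeplerPricingConsequences
import Summits.AtomisticToContinuum.Crystallization.Theorems.FluxTubeKeplerFluxCellKeplerEnergyIdentity

/-!
# Line `single-scale` — skeleton for crux `FluxTubeKepler.FluxCellKepler` (stmt-AtomisticToContinuum-15221)

Crux-strategist line (planner-cstrat-stmt-AtomisticToContinuum-15221-0, 2026-08-17).  SAME transversal
cut as the lead's line `Sketch` (τ-free defect pricing + coercive flux-cell localisation), with the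
τ-free stub WEAKENED TO ONE PATTERN SCALE: `stub_pricingAtScaleTwo` asks the linear defect pricing
`c · #bad_(2,η) ≤ E − N e*` only for the radius-2 test of the crux's layered-good predicate (all
`δ`, all `η`), instead of `Sketch.stub_defectPricedExcess` (all radii `R`).  The missing direction is
LANDED in the tree, potential-free and sorry-free (`Theorems/FluxTubeKeplerFluxCellKeplerSingleScale.lean`,
p167667, commit e4af14037dc0; imported here): `good_of_locallyGood` (chart gluing for the
crux predicate: compactness `exists_subseq_forall_eventually_ballMatch` + `exactNear_of_limit` +
the landed exact local-to-global rigidity of box templates `exactLayeredRigidity_holds`) and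
`card_bad_le` (`#bad_(R,η) ≤ (2ρ/δ+1)³ · #bad_(2,η')`), whence `pricingAll_of_pricingAtTwo`.  The
second stub `stub_coerciveFluxCells` is VERBATIM the lead's (the route's Thomson / flux-tube bet:
a local credit with DOM whose over-credit is at most a `θ < 1` fraction of the excess energy).
Assembly `FluxCellKepler_of` = `pricingAll_of_pricingAtTwo` followed by the algebra of
`Sketch.FluxCellKepler_of` (periodic minimiser from the pricing via
`FluxCellKeplerSketch.crysPeriodicMinAttained_of_defectPricing`, energy identity
`FluxCellKeplerSketch.interactionEnergy_lennardJones_eq_sum`, `c' = (1 − θ) c`).  The landed file also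
proves the registered helpers `stub_chartGluing`, `stub_singleScaleReduction` and the named reduction
`FluxCellKeplerSingleScale.fluxCellKepler_of_singleScale : 2 ≤ R₀ → SingleScaleFluxCellKepler R₀ → FluxCellKepler`
(v2 of this skeleton: the v1 in-file copies are replaced by the import).

Why a separate line at all: every local-score attack on the crux (one-centre table + facet
transfer, m-potential / envelope, registered ledger) reaches ONE pattern scale only; the lead may
adopt this weaker first stub at a cycle boundary without touching anything else.  Honest status:
`stub_pricingAtScaleTwo` is still summit-strength (it implies `Crystallization` through
`pricingAll_of_pricingAtTwo` + `FluxCellKeplerSketch.crystallization_of_defectPricing`); the line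
relocates the scale quantifier, not the difficulty (STRATEGY-CENSUS.md of the crux).
-/

noncomputable section

open scoped BigOperators Classical
open Filter Topology

namespace Summit.AtomisticToContinuum.Crystallization.Cruxes.FluxCellKepler.SingleScale

open Summit.AtomisticToContinuum.Crystallization.Theses.PhononSlackCertificates
open Summit.AtomisticToContinuum.Crystallization.Theorems.PrestressSplitKorn
open Summit.AtomisticToContinuum.Crystallization.Theorems.HullBridgeExact
open Summit.AtomisticToContinuum.Crystallization.Theorems.FluxCellKeplerSketchGaps
open Literature.MathematicalPhysics.StatisticalMechanics Literature.Geometry.DiscreteGeometry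

local notation "E3" => EuclideanSpace ℝ (Fin 3)

/-! ## The declared stubs (the only `sorry`s of the file) -/

/-- **Stub 1 — defect-priced excess energy AT PATTERN SCALE 2 (τ-free quantitative crystallization
onto the layered family, one test radius).** For every separation `δ > 0` and every tolerance
`η > 0` there is `c > 0` such that on every finite `δ`-separated configuration of distinct points
the Lennard-Jones energy exceeds `N · e*` (`e*` = the periodic infimum of the energy per particle)
by at least `c` per site whose radius-2 neighbourhood of relative positions is not two-way
`η`-matched with a member of the relaxed Barlow / layered family (spacing `a ∈ [47/50, 1]`, free
Hägg word, interlayer increments in `[39a/50, 17a/20]`).  Equivalent to the all-scales pricing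
(`pricingAll_of_pricingAtTwo` below and monotonicity); a consequence of the crux; `c(η)` may be as
small as `μ η²` (uniform shear); false iff a non-layered competitor ties `e*`. [conjecture] -/
theorem stub_pricingAtScaleTwo :
    ∀ δ : ℝ, 0 < δ → ∀ η : ℝ, 0 < η → ∃ c : ℝ, 0 < c ∧
      ∀ (N : ℕ) (x : Fin N → EuclideanSpace ℝ (Fin 3)), Function.Injective x →
        (∀ i j, i ≠ j → δ ≤ dist (x i) (x j)) →
        c * (Nat.card {i : Fin N // ¬ ∃ a : ℝ, 47 / 50 ≤ a ∧ a ≤ 1 ∧ ∃ (A : EuclideanSpace ℝ (Fin 3) →ₗᵢ[ℝ] EuclideanSpace ℝ (Fin 3)) (s : ℤ → ℤ) (z : ℤ → ℝ), IsHaggSeq s ∧ (∀ m : ℤ, 39 / 50 * a ≤ z (m + 1) - z m ∧ z (m + 1) - z m ≤ 17 / 20 * a) ∧ let S : Set (EuclideanSpace ℝ (Fin 3)) := {p | ∃ m k l : ℤ, p = A (((k : ℝ) • triangularVec₁ a) + ((l : ℝ) • triangularVec₂ a) + ((haggLabel s m : ℝ) • barlowOffset a) + (z m • layerNormal 1))};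 (∀ p ∈ S, ‖p‖ ≤ 2 → ∃ j : Fin N, dist (x j - x i) p ≤ η) ∧ (∀ j : Fin N, ‖x j - x i‖ ≤ 2 → ∃ p ∈ S, dist (x j - x i) p ≤ η)} : ℝ)
          ≤ interactionEnergy lennardJones x
              - (N : ℝ) * ⨅ Q : PeriodicConfiguration 3, Q.energyPerParticle lennardJones := by
  sorry

/-- **Stub 2 — coercive flux-cell localisation of the `r⁻⁶` tail** (VERBATIM the lead's
`Sketch.stub_coerciveFluxCells`; the Thomson / flux-tube content of the route).  There are a radius
`R₁` and a LOCAL tail credit `τ` with (DOM) `Σ_i site₆,i ≤ Σ_i τ(pattern_i)` on every finite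
injective configuration, and for every `δ > 0` some `θ < 1` with
`Σ_i τ(pattern_i) − Σ_i site₆,i ≤ 12 θ (E(x) − N e*)` on `δ`-separated configurations.  Not implied
by the crux (which gives `θ = 1`); necessarily `θ ≥ R₁⁻⁶/(12|e*|)` (landed
`FluxTubeKeplerFluxCellKeplerCoerciveConstraints`). [conjecture] -/
theorem stub_coerciveFluxCells :
    ∃ (R₁ : ℝ) (τ : Finset (EuclideanSpace ℝ (Fin 3)) → ℝ),
      (∀ (N : ℕ) (x : Fin N → EuclideanSpace ℝ (Fin 3)), Function.Injective x →
        ∑ i, siteEnergy (fun r => (r⁻¹) ^ 6) x i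
          ≤ ∑ i, τ ((Finset.univ.filter fun j : Fin N => dist (x j) (x i) ≤ R₁).image fun j => x j - x i)) ∧
      (∀ δ : ℝ, 0 < δ → ∃ θ : ℝ, θ < 1 ∧
        ∀ (N : ℕ) (x : Fin N → EuclideanSpace ℝ (Fin 3)), Function.Injective x →
          (∀ i j, i ≠ j → δ ≤ dist (x i) (x j)) →
          ∑ i, τ ((Finset.univ.filter fun j : Fin N => dist (x j) (x i) ≤ R₁).image fun j => x j - x i)
              - ∑ i, siteEnergy (fun r => (r⁻¹) ^ 6) x i
            ≤ 12 * θ * (interactionEnergy lennardJones x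
                - (N : ℝ) * ⨅ Q : PeriodicConfiguration 3, Q.energyPerParticle lennardJones)) := by
  sorry

/-! ## The stub statements as named propositions (verbatim) -/

/-- Statement of `stub_pricingAtScaleTwo` (verbatim). [conjecture] -/
def Sig.stub_pricingAtScaleTwo : Prop :=
    ∀ δ : ℝ, 0 < δ → ∀ η : ℝ, 0 < η → ∃ c : ℝ, 0 < c ∧
      ∀ (N : ℕ) (x : Fin N → EuclideanSpace ℝ (Fin 3)), Function.Injective x →
        (∀ i j, i ≠ j → δ ≤ dist (x i) (x j)) →
        c * (Nat.card {i : Fin N // ¬ ∃ a : ℝ, 47 / 50 ≤ a ∧ a ≤ 1 ∧ ∃ (A : EuclideanSpace ℝ (Fin 3) →ₗᵢ[ℝ] EuclideanSpace ℝ (Fin 3)) (s : ℤ → ℤ) (z : ℤ → ℝ), IsHaggSeq s ∧ (∀ m : ℤ, 39 / 50 * a ≤ z (m + 1) - z m ∧ z (m + 1) - z m ≤ 17 / 20 * a) ∧ let S : Set (EuclideanSpace ℝ (Fin 3)) := {p | ∃ m k l : ℤ, p = A (((k : ℝ) • triangularVec₁ a) + ((l : ℝ) • triangularVec₂ a) +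 ((haggLabel s m : ℝ) • barlowOffset a) + (z m • layerNormal 1))}; (∀ p ∈ S, ‖p‖ ≤ 2 → ∃ j : Fin N, dist (x j - x i) p ≤ η) ∧ (∀ j : Fin N, ‖x j - x i‖ ≤ 2 → ∃ p ∈ S, dist (x j - x i) p ≤ η)} : ℝ)
          ≤ interactionEnergy lennardJones x
              - (N : ℝ) * ⨅ Q : PeriodicConfiguration 3, Q.energyPerParticle lennardJones

/-- Statement of `stub_coerciveFluxCells` (verbatim). [conjecture] -/
def Sig.stub_coerciveFluxCells : Prop :=
    ∃ (R₁ : ℝ) (τ : Finset (EuclideanSpace ℝ (Fin 3)) → ℝ),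
      (∀ (N : ℕ) (x : Fin N → EuclideanSpace ℝ (Fin 3)), Function.Injective x →
        ∑ i, siteEnergy (fun r => (r⁻¹) ^ 6) x i
          ≤ ∑ i, τ ((Finset.univ.filter fun j : Fin N => dist (x j) (x i) ≤ R₁).image fun j => x j - x i)) ∧
      (∀ δ : ℝ, 0 < δ → ∃ θ : ℝ, θ < 1 ∧
        ∀ (N : ℕ) (x : Fin N → EuclideanSpace ℝ (Fin 3)), Function.Injective x →
          (∀ i j, i ≠ j → δ ≤ dist (x i) (x j)) →
          ∑ i, τ ((Finset.univ.filter fun j : Fin N => dist (x j) (x i) ≤ R₁).image fun j => x j - x i)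
              - ∑ i, siteEnergy (fun r => (r⁻¹) ^ 6) x i
            ≤ 12 * θ * (interactionEnergy lennardJones x
                - (N : ℝ) * ⨅ Q : PeriodicConfiguration 3, Q.energyPerParticle lennardJones))

/-! ## Sorry-free machinery: chart gluing `good_of_locallyGood`, counting `card_bad_le` and the crux
predicate `LayeredGood` are IMPORTED from the landed `Theorems/FluxTubeKeplerFluxCellKeplerSingleScale.lean`
(namespace `FluxCellKeplerSingleScale`, opened below). -/

open Summit.AtomisticToContinuum.Crystallization.Theorems.FluxCellKeplerSingleScale

/-! ## Pricing at every scale from pricing at scale 2 -/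

/-- **All scales from scale 2.** `stub_pricingAtScaleTwo` gives the all-scales pricing (verbatim
the statement of `Sketch.stub_defectPricedExcess`): for `R ≤ 2` by monotonicity of the predicate in
the radius, for `R > 2` by `card_bad_le` with the constant `c(δ, η')/M`. [folklore] -/
theorem pricingAll_of_pricingAtTwo (h : Sig.stub_pricingAtScaleTwo) :
    ∀ δ : ℝ, 0 < δ → ∀ R η : ℝ, 0 < R → 0 < η → ∃ c : ℝ, 0 < c ∧
      ∀ (N : ℕ) (x : Fin N → EuclideanSpace ℝ (Fin 3)), Function.Injective x →
        (∀ i j, i ≠ j → δ ≤ dist (x i) (x j)) →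
        c * (Nat.card {i : Fin N // ¬ ∃ a : ℝ, 47 / 50 ≤ a ∧ a ≤ 1 ∧ ∃ (A : EuclideanSpace ℝ (Fin 3) →ₗᵢ[ℝ] EuclideanSpace ℝ (Fin 3)) (s : ℤ → ℤ) (z : ℤ → ℝ), IsHaggSeq s ∧ (∀ m : ℤ, 39 / 50 * a ≤ z (m + 1) - z m ∧ z (m + 1) - z m ≤ 17 / 20 * a) ∧ let S : Set (EuclideanSpace ℝ (Fin 3)) := {p | ∃ m k l : ℤ, p = A (((k : ℝ) • triangularVec₁ a) + ((l : ℝ) • triangularVec₂ a) + ((haggLabel s m : ℝ) • barlowOffset a) + (z m • layerNormal 1))}; (∀ p ∈ S, ‖p‖ ≤ R → ∃ j : Fin N, dist (x j - x i) p ≤ η) ∧ (∀ j : Fin N, ‖x j - x i‖ ≤ R → ∃ p ∈ S, dist (x j - x i) p ≤ η)} : ℝ)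
          ≤ interactionEnergy lennardJones x
              - (N : ℝ) * ⨅ Q : PeriodicConfiguration 3, Q.energyPerParticle lennardJones := by
  intro δ hδ R η hR hη
  by_cases hRR : R ≤ 2
  · obtain ⟨c, hc, hcb⟩ := h δ hδ η hη
    refine ⟨c, hc, fun N x hx hsep => ?_⟩
    show c * (Nat.card {i : Fin N // ¬ LayeredGood R η x i} : ℝ) ≤ _
    have hmono : (Nat.card {i : Fin N // ¬ LayeredGood R η x i} : ℝ) ≤
        Nat.card {i : Fin N // ¬ LayeredGood 2 η x i} := by
      have hle : Nat.card {i : Fin N // ¬ LayeredGood R η x i} ≤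
          Nat.card {i : Fin N // ¬ LayeredGood 2 η x i} := by
        rw [Nat.card_eq_fintype_card, Nat.card_eq_fintype_card]
        exact Fintype.card_subtype_mono _ _ fun i hi hg => hi (layeredGood_mono hRR x i hg)
      exact_mod_cast hle
    exact (mul_le_mul_of_nonneg_left hmono hc.le).trans (hcb N x hx hsep)
  · obtain ⟨η', hη', M, hM, hcount⟩ := card_bad_le (le_refl (2 : ℝ)) hδ R η hη
    obtain ⟨c, hc, hcb⟩ := h δ hδ η' hη'
    refine ⟨c / M, div_pos hc hM, fun N x hx hsep => ?_⟩
    show c / M * (Nat.card {i : Fin N // ¬ LayeredGood R η x i} : ℝ) ≤ _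
    have h1 := hcount N x hsep
    have h2 := hcb N x hx hsep
    have h3 : c / M * (Nat.card {i : Fin N // ¬ LayeredGood R η x i} : ℝ) ≤
        c * Nat.card {i : Fin N // ¬ LayeredGood 2 η' x i} := by
      calc c / M * (Nat.card {i : Fin N // ¬ LayeredGood R η x i} : ℝ)
          ≤ c / M * (M * Nat.card {i : Fin N // ¬ LayeredGood 2 η' x i}) :=
            mul_le_mul_of_nonneg_left h1 (div_pos hc hM).le
        _ = c * Nat.card {i : Fin N // ¬ LayeredGood 2 η' x i} := by
            field_simp
    exact h3.trans h2

/-! ## The skeleton theorem: the crux BY NAME from the two stub statements (sorry-free) -/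

/-- **Assembly.** `stub_pricingAtScaleTwo → stub_coerciveFluxCells → FluxCellKepler` (the route's
crux decl, by name).  All scales from scale 2 (`pricingAll_of_pricingAtTwo`); the periodic
minimiser `P₀` from the pricing (`FluxCellKeplerSketch.crysPeriodicMinAttained_of_defectPricing`,
landed), so `e(P₀) = e*`; `(R₁, τ)`, DOM and `θ < 1` from stub 2; on a `δ`-separated `x` the energy
identity gives `Σ_i ((1/24) site₁₂ − (1/12) τ_i) = E − (Σ τ − Σ site₆)/12 ≥ E − θ (E − N e*)`, so
the cell sum exceeds `N e*` by `(1 − θ)(E − N e*) ≥ (1 − θ) c · #bad`. [folklore] -/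
theorem FluxCellKepler_of (h₂ : Sig.stub_pricingAtScaleTwo) (h₃ : Sig.stub_coerciveFluxCells) :
    Summit.AtomisticToContinuum.Crystallization.Theses.FluxTubeKepler.FluxCellKepler := by
  have hall := pricingAll_of_pricingAtTwo h₂
  obtain ⟨P₀, hP₀⟩ :=
    Summit.AtomisticToContinuum.Crystallization.Theorems.FluxCellKeplerSketch.crysPeriodicMinAttained_of_defectPricing
      hall
  obtain ⟨R₁, τ, hdom, hsharp⟩ := h₃
  have he : (⨅ Q : PeriodicConfiguration 3, Q.energyPerParticle lennardJones)
      = P₀.energyPerParticle lennardJones := by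
    rw [← sInf_range]
    exact hP₀.csInf_eq
  refine ⟨P₀, R₁, τ, hdom, ?_⟩
  intro δ hδ R η hR hη
  obtain ⟨θ, hθ, hθb⟩ := hsharp δ hδ
  obtain ⟨c, hc, hcb⟩ := hall δ hδ R η hR hη
  refine ⟨(1 - θ) * c, mul_pos (sub_pos.2 hθ) hc, ?_⟩
  intro N x hx hsep
  have hG := hcb N x hx hsep
  have hL := hθb N x hx hsep
  rw [he] at hG hL
  have hsum : ∑ i, ((1 / 24 : ℝ) * siteEnergy (fun r => (r⁻¹) ^ 12) x i
        - (1 / 12 : ℝ) * τ ((Finset.univ.filter fun j : Fin N => dist (x j) (x i) ≤ R₁).image fun j => x j - x i))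
      = interactionEnergy lennardJones x
        - (1 / 12 : ℝ) * (∑ i, τ ((Finset.univ.filter fun j : Fin N => dist (x j) (x i) ≤ R₁).image fun j => x j - x i)
            - ∑ i, siteEnergy (fun r => (r⁻¹) ^ 6) x i) := by
    rw [Summit.AtomisticToContinuum.Crystallization.Theorems.FluxCellKeplerSketch.interactionEnergy_lennardJones_eq_sum,
      Finset.sum_sub_distrib, Finset.sum_sub_distrib, ← Finset.mul_sum, ← Finset.mul_sum, ← Finset.mul_sum]
    ring
  rw [hsum]
  have h1 : (1 - θ) * (c * (Nat.card {i : Fin N // ¬ ∃ a : ℝ, 47 / 50 ≤ a ∧ a ≤ 1 ∧ ∃ (A : EuclideanSpace ℝ (Fin 3) →ₗᵢ[ℝ] EuclideanSpace ℝ (Fin 3)) (s : ℤ → ℤ) (z : ℤ → ℝ), IsHaggSeq s ∧ (∀ m : ℤ, 39 / 50 * a ≤ z (m + 1) - z m ∧ z (m + 1) - z m ≤ 17 / 20 * a) ∧ let S : Set (EuclideanSpace ℝ (Fin 3)) := {p | ∃ m k l : ℤ, p = A (((k : ℝ) • triangularVec₁ a) + ((l : ℝ) • triangularVec₂ a) +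 ((haggLabel s m : ℝ) • barlowOffset a) + (z m • layerNormal 1))}; (∀ p ∈ S, ‖p‖ ≤ R → ∃ j : Fin N, dist (x j - x i) p ≤ η) ∧ (∀ j : Fin N, ‖x j - x i‖ ≤ R → ∃ p ∈ S, dist (x j - x i) p ≤ η)} : ℝ))
      ≤ (1 - θ) * (interactionEnergy lennardJones x - (N : ℝ) * P₀.energyPerParticle lennardJones) :=
    mul_le_mul_of_nonneg_left hG (sub_nonneg.2 hθ.le)
  nlinarith [h1, hL]

/-- **Honest strength of stub 1.** `stub_pricingAtScaleTwo` ALONE already gives the sub-problem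
`Crystallization` (all scales by `pricingAll_of_pricingAtTwo`, then the landed
`FluxCellKeplerSketch.crystallization_of_defectPricing`): in this transversal cut the flux-cell stub is
load-bearing for the crux as typed, not for the summit (STRATEGY-CENSUS.md §Decomposition D1). [folklore] -/
theorem crystallization_of_pricingAtScaleTwo (h₂ : Sig.stub_pricingAtScaleTwo) : _root_.Crystallization :=
  Summit.AtomisticToContinuum.Crystallization.Theorems.FluxCellKeplerSketch.crystallization_of_defectPricing
    (pricingAll_of_pricingAtTwo h₂)

/-- **The closed skeleton instance**: the crux by name from the two declared stubs (the only place
`sorry` enters). [conjecture] -/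
theorem FluxCellKepler_skeleton :
    Summit.AtomisticToContinuum.Crystallization.Theses.FluxTubeKepler.FluxCellKepler :=
  FluxCellKepler_of stub_pricingAtScaleTwo stub_coerciveFluxCells

end Summit.AtomisticToContinuum.Crystallization.Cruxes.FluxCellKepler.SingleScale

end
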